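import Literature.MathematicalPhysics.QuantumFieldTheory.Balaban1983to89.B9Eq326MultiLevelAssembly

/-!
# `Balaban1983to89.B9Eq326MultiLevelSmallField` — [Balaban1985BackgroundPropagators] (3.26)–(3.27) p. 395 IN THE SMALL-FIELD GEOMETRY: with no
# large-field holes (`Ω₀ = T_η`, `Λ_j = ∅` for `j < k`, `Λ_k = T^{(k)}`) the multi-level `Δ_a(U)`, `R(U)`, `Q*(U)aQ(U)`, `G(U)` of
# `B9Eq326MultiLevelAssembly` ARE the pub-balaban NE9 chain's `k`-th-step objects `B9Eq326OperatorTower.laplaceAk` / `RofUk` / `QkW†(aQkW)` / `G1k`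
# — the chain's declared reading «(M3) one number a … only the level j = k survives» made a theorem — seat r06 (B9 fold owner) gen 25, row B9.Eq3.26

statement-level skeleton of published theorems with citation tags; proofs where landed; nothing here is a claim about the Yang–Mills mass gap

CITATION HEADER (lean-in-tree rule).  T. Bałaban, *Propagators for lattice gauge theories in a background field*, Commun. Math. Phys. **99** (1985)
389–434 [Balaban1985BackgroundPropagators] (held `paper:balaban1985-cmp99-background-propagators`, journal page = PDF page + 388), pp. 393–395
[PDF 5–7] read by this seat 2026-08-23 (quotations in `B9Eq326MultiLevelAssembly`).  p. 393: «thus we have Ω₀ ⊃ Ω₁ ⊃ ⋯ ⊃ Ω_k, Ω_j ⊂ T_η, and we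
define Λ_j = Ω_j^{(j)} ∖ Ω_{j+1}^{(j)}, j = 0, 1, …, k, Ω_{k+1} = ∅»; (3.16), (3.18), (3.21), (3.26)–(3.27) as quoted there.  `B9Eq326OperatorTower`
(pub-balaban NE9, p301454) header: «In the small-field k-th step (no large-field regions, Ω_j = T for all j) only the level j = k survives in
(3.16)/(3.24): Q = Q_k(U), Q′ = Q′_k(U) — the COMPOSITES of (3.15)/(3.19)» and «(M3) one number a (print's (3.16)/(3.24) carry a_j, (L^jη)^{d−2} — at
the single surviving level a rescaling of a/c₁)».

WHY THIS FILE.  Row B9.Eq3.26's cross-family members (`B9Eq326OperatorTower.laplaceAk`, `RofUk`, `QkW`, `G1k`; the NE9 letter chain's central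
operator) were typed with the TOP composite `Q_k(U)` only, `R` onto `Δ_U N(Q′_k(U))`, on the whole torus; `B9Eq326MultiLevelAssembly` (r06 g25 FILE 70)
typed print's multi-level (3.26)/(3.27) with the Dirichlet `Ω₀`.  This file PROVES that the former is the special case of the latter in the
geometry print describes for the small-field step: take `Ω₀ = T_η` (every site), `Λ_j = ∅` for `j < k` and `Λ_k =` all of `T^{(k)}` (letters
`ΛS`, `ΛB` with exactly these values — hypotheses `hS`, `hS'`, `hB`, `hB'`), and the NE9 unit-torus weight `c₁ = (L^kη)^{d−2}` (`hc₁`).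
WHAT IS PROVED (theorems only; 0 def, 0 named fact, 0 sorry, standard axioms).  At `k = n + 1` levels (the NE9 indexing), one background `U` on
`T_η = T_{L^{n+1} m}`:
* `QprimeStack_eq_zero_iff_top` — the stacked (3.18) constraint `Q′λ = 0` IS `Q′_k(U)λ = 0` (`B9Eq315QTower.QprimeTower`).
* **`Rtorus_univ_eq_RofUk`** — `Ω₀R(U)Ω₀` of (3.21) built in `L²(Ω₀, 𝔤)` from the Dirichlet Laplacian and the multi-level `Q′`, `Ω₀ = T_η`, EQUALS NE9's
  `RofUk` (the projection onto `Δ_U N(Q′_k(U))`): both are the orthogonal projection onto the same subspace (characterization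
  `Submodule.eq_starProjection_of_mem_of_inner_eq_zero`; the restriction/extension pair of FILE 70 §3 is inverse to each other on `T_η`).
* `norm_sq_Qstack_smallField`, **`QaQ_smallField_eq`** — (3.16) has the single term `j = k`: `‖QA‖²_{L²(𝔅)} = ‖Q_kW A‖²_{c₁}`, hence
  `Q*(U)aQ(U) = Q_kW†(aQ_kW)` (complex polarization `inner_map_self_eq_zero`).
* **`laplaceA_smallField_eq_laplaceAk`** — (3.26): `B9Eq326MultiLevelAssembly.laplaceA … univ ΛS ΛB … a = B9Eq326OperatorTower.laplaceAk … a`.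
* `bondsIn_univ`, `hpos_dirichlet_univ` (the positivity hypothesis of FILE 70's `G` for `Ω₀ = T_η` follows from NE9's for `laplaceAk`), and
  **`Gtorus_smallField_eq_G1k`** — (3.27): `Ω₀G(U)Ω₀ = G1k` (left inverse = right inverse of the same operator).
HONEST SCOPE.  [folklore] finite-dimensional bookkeeping between two typings of the cell's own objects at printed formulas; no estimate; the
letters `Λ_j`, `Ω₀` are instantiated, not derived from a cube geometry; the displayed data ([5] Prop. 2 per level, Theorem 3.11's positivity) are
the NE9 files' hypotheses verbatim.  NOT summit progress (cell pub-balaban: NE9 NOT PRINTED / NOT PROVED).  New file importing `B9Eq326MultiLevelAssembly`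
(hence `B9Eq326OperatorTower`); nothing modified.  Net new unproved facts: 0.
-/

noncomputable section

open scoped InnerProductSpace ComplexConjugate BigOperators

namespace Literature.MathematicalPhysics.QuantumFieldTheory.Balaban1983to89.B9Eq326MultiLevelSmallField

open B4Sect5Torus (TSite)
open B9SectCLatticeCarrier (Bond)
open B7Prop1Explicit (U1 Wcx boxVec)
open B9Eq311L2Pairing (WL2)
open B11Eq103H1Complex (SiteL2K BondL2K covLaplaceSiteK)
open B9Eq310HessianOperator (adTransportW hessOp)
open B9Eq315QTorus (perCfg cornerSite)
open B9Eq315QTower (towerP UlevOf QprimeTower)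
open B9Eq326MultiLevelAssembly
open LatticeNorms (scaleLen)

variable {d : ℕ}

section SmallField

open B9Eq326OperatorTower (QprimeTowerW RofUk QkW laplaceAk G1k)

variable {𝔸 : Type*} [NormedRing 𝔸] [NormedAlgebra ℂ 𝔸] [CompleteSpace 𝔸] [NormOneClass 𝔸]
  (L : ℕ) [NeZero L] (m : Fin d → ℕ) [∀ i, NeZero (m i)] (n : ℕ)
  {W : Type*} [NormedAddCommGroup W] [InnerProductSpace ℂ W] [FiniteDimensional ℂ W] (φ : W ≃ₗ[ℂ] 𝔸) {c₀ c₁ : ℝ} [Fact (0 < c₀)] [Fact (0 < c₁)]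
  (η : ℝ) (U : Bond d (towerP L m (n + 1)) → 𝔸ˣ)
  (ΛS : (j : Fin (n + 1 + 1)) → Finset (TSite d (towerP L m (n + 1 - j))))
  (ΛB : (j : Fin (n + 1 + 1)) → Finset (Bond d (towerP L m (n + 1 - j))))

omit [∀ i, NeZero (m i)] [FiniteDimensional ℂ W] [Fact (0 < c₀)] in
/-- In the small-field geometry (`Λ_j = ∅` for `j < k`, `Λ_k = T^{(k)}`) the stacked `Q′` of (3.18) vanishes iff the TOP composite `Q′_k` of the NE9 chain does.
[cite: Balaban1985BackgroundPropagators, (3.18)–(3.19) p.393] -/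
theorem QprimeStack_eq_zero_iff_top (hS : ∀ j : Fin (n + 1 + 1), (j : ℕ) ≠ n + 1 → ΛS j = ∅) (hS' : ΛS (Fin.last (n + 1)) = Finset.univ)
    (Rlev : (j : ℕ) → Bond d (towerP L m (j + 1)) → W →ₗ[ℂ] W) (l : SiteL2K ℂ d (towerP L m (n + 1)) c₀ W) :
    QprimeStack L m (n + 1) ΛS (c₀ := c₀) Rlev l = 0 ↔ QprimeTower L m Rlev (n + 1) (WL2.equiv ℂ _ W l) = 0 := by
  have key : ∀ i : ℕ, i = 0 → ((∀ z : TSite d (towerP L m i), QprimeLevels L m Rlev (n + 1) (WL2.equiv ℂ _ W l) i z = 0) ↔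
      QprimeTower L m Rlev (n + 1) (WL2.equiv ℂ _ W l) = 0) := by
    rintro i rfl
    rw [← QprimeLevels_zero_eq_QprimeTower]
    exact ⟨fun h => funext h, fun h z => congrFun h z⟩
  have hidx : n + 1 - ((Fin.last (n + 1) : Fin (n + 1 + 1)) : ℕ) = 0 := by simp
  rw [← key _ hidx]
  constructor
  · intro h z
    have hz : z ∈ ΛS (Fin.last (n + 1)) := by rw [hS']; exact Finset.mem_univ z
    have := congrFun h ⟨Fin.last (n + 1), ⟨z, hz⟩⟩
    rwa [QprimeStack_apply] at this
  · intro h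
    funext x
    obtain ⟨j, y, hy⟩ := x
    by_cases hj : (j : ℕ) = n + 1
    · have hjl : j = Fin.last (n + 1) := Fin.ext (by rw [hj]; rfl)
      subst hjl
      rw [QprimeStack_apply]
      exact h y
    · exact absurd (by rw [hS j hj] at hy; exact hy) (Finset.notMem_empty y)

omit [NormOneClass 𝔸] in
/-- **`R(U)` of (3.21) in the small-field geometry IS the NE9 chain's `RofUk`**: with `Ω₀ = T_η` (no Dirichlet cut) and `Λ_j = ∅` for `j < k`, the
projection onto `Δ^η_U N(Q′)` built in `L²(Ω₀, 𝔤)` from the multi-level `Q′` and read on `L²(T_η, 𝔤)` equals the projection onto `Δ_U N(Q′_k(U))`.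
[cite: Balaban1985BackgroundPropagators, (3.21) p.394] -/
theorem Rtorus_univ_eq_RofUk (hS : ∀ j : Fin (n + 1 + 1), (j : ℕ) ≠ n + 1 → ΛS j = ∅) (hS' : ΛS (Fin.last (n + 1)) = Finset.univ) :
    Rtorus L m (n + 1) φ η U Finset.univ ΛS (c₀ := c₀) = RofUk L m n φ η U := by
  -- the two letters of RofUk
  set Δs := covLaplaceSiteK (c₀ := c₀) ((η : ℂ))⁻¹ (adTransportW φ U) (adTransportW φ fun b => (U b)⁻¹) with hΔs
  set Qp := QprimeTowerW L m n φ U (c₀ := c₀) with hQp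
  haveI : CompleteSpace ↥((LinearMap.ker Qp).map Δs) := FiniteDimensional.complete ℂ _
  have hext : ∀ f : SiteL2K ℂ d (towerP L m (n + 1)) c₀ W, extOn ℂ Finset.univ (resOn ℂ Finset.univ f) = f := by
    intro f; funext i
    exact (chiOn_apply ℂ Finset.univ f i).trans (if_pos (Finset.mem_univ i))
  -- kernel dictionary: Q′dir (res f) = 0 ↔ Qp f = 0
  have hker : ∀ f : SiteL2K ℂ d (towerP L m (n + 1)) c₀ W,
      QprimeDir L m (n + 1) φ U Finset.univ ΛS (resOn ℂ Finset.univ f) = 0 ↔ Qp f = 0 := by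
    intro f
    rw [QprimeDir, LinearMap.comp_apply, hext, QprimeStack_eq_zero_iff_top L m n ΛS hS hS']
    rfl
  apply LinearMap.ext
  intro f
  symm
  show ((LinearMap.ker Qp).map Δs).starProjection f = extOn ℂ Finset.univ (Rdir L m (n + 1) φ η U Finset.univ ΛS (resOn ℂ Finset.univ f))
  refine Submodule.eq_starProjection_of_mem_of_inner_eq_zero ?_ fun w hw => ?_
  · -- (a) membership: Rdir g = lapDir l, Q′dir l = 0
    obtain ⟨l, hl, hRl⟩ := exists_ker_Rdir_eq L m (n + 1) φ η U Finset.univ ΛS (resOn ℂ Finset.univ f)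
    rw [hRl, lapDir, LinearMap.comp_apply, LinearMap.comp_apply, hext]
    refine Submodule.mem_map_of_mem (LinearMap.mem_ker.2 ?_)
    rw [← hker, resOn_extOn]
    exact hl
  · -- (b) orthogonality
    obtain ⟨w', hw', rfl⟩ := Submodule.mem_map.1 hw
    have hw'k : Qp w' = 0 := LinearMap.mem_ker.1 hw'
    haveI : CompleteSpace ↥((LinearMap.ker (QprimeDir L m (n + 1) φ U Finset.univ ΛS (c₀ := c₀))).map
        (lapDir L m (n + 1) φ η U Finset.univ)) := FiniteDimensional.complete ℂ _
    have hRdir : ∀ g : L2On ℂ (Finset.univ : Finset (TSite d (towerP L m (n + 1)))) c₀ W,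
        Rdir L m (n + 1) φ η U Finset.univ ΛS g =
          ((LinearMap.ker (QprimeDir L m (n + 1) φ U Finset.univ ΛS (c₀ := c₀))).map (lapDir L m (n + 1) φ η U Finset.univ)).starProjection g :=
      fun g => rfl
    have hmem : resOn ℂ Finset.univ (Δs w') ∈
        (LinearMap.ker (QprimeDir L m (n + 1) φ U Finset.univ ΛS (c₀ := c₀))).map (lapDir L m (n + 1) φ η U Finset.univ) :=
      Submodule.mem_map.2 ⟨resOn ℂ Finset.univ w', LinearMap.mem_ker.2 ((hker w').2 hw'k),
        by rw [lapDir, LinearMap.comp_apply, LinearMap.comp_apply, hext]⟩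
    have h0 := Submodule.starProjection_inner_eq_zero (resOn ℂ Finset.univ f) _ hmem
    rw [← hRdir] at h0
    calc ⟪f - extOn ℂ Finset.univ (Rdir L m (n + 1) φ η U Finset.univ ΛS (resOn ℂ Finset.univ f)), Δs w'⟫_ℂ
        = ⟪extOn ℂ Finset.univ (resOn ℂ Finset.univ f - Rdir L m (n + 1) φ η U Finset.univ ΛS (resOn ℂ Finset.univ f)), Δs w'⟫_ℂ := by
          rw [map_sub, hext]
      _ = ⟪resOn ℂ Finset.univ f - Rdir L m (n + 1) φ η U Finset.univ ΛS (resOn ℂ Finset.univ f), resOn ℂ Finset.univ (Δs w')⟫_ℂ :=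
          inner_extOn_left ℂ Finset.univ _ _
      _ = 0 := h0

variable [Fact (0 < η)] (hL : 1 ≤ L) (α : ℕ → ℝ) (hα1 : ∀ j, α j ≤ 1 / 64)
  (hU1 : ∀ (j : ℕ) (x : B7Prop1Explicit.Site d) (κ : Fin d), perCfg (towerP L m (j + 1)) (UlevOf L m (n + 1) U j) x κ ∈ U1 𝔸)
  (hreg : ∀ (j : ℕ) (y : TSite d (towerP L m j)) (κ : Fin d) (r : Fin d → Fin L),
    ‖((Wcx L (perCfg (towerP L m (j + 1)) (UlevOf L m (n + 1) U j)) (cornerSite L y) κ (boxVec L r) : 𝔸ˣ) : 𝔸) - 1‖ ≤ α j)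

omit [FiniteDimensional ℂ W] [Fact (0 < c₀)] in
/-- In the small-field geometry the (3.16) norm of the stacked averaging is the single top-level term: `‖QA‖² = (L^kη)^{d−2}·Σ_b|(Q_k(U)A)(b)|²`,
i.e. `c₁·Σ_b‖(QkW A)(b)‖²` for the NE9 weight `c₁ = (L^kη)^{d−2}`. [cite: Balaban1985BackgroundPropagators, (3.16) p.393] -/
theorem norm_sq_Qstack_smallField (hB : ∀ j : Fin (n + 1 + 1), (j : ℕ) ≠ n + 1 → ΛB j = ∅) (hB' : ΛB (Fin.last (n + 1)) = Finset.univ)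
    (hc₁ : c₁ = scaleLen (L : ℝ) η (n + 1) ^ ((d : ℤ) - 2)) (A : BondL2K ℂ d (towerP L m (n + 1)) c₀ W) :
    ‖Qstack L m (n + 1) η ΛB φ hL (UlevOf L m (n + 1) U) α hα1 hU1 hreg A‖ ^ 2 = ‖QkW L m n φ U hL α hα1 hU1 hreg (c₀ := c₀) (c₁ := c₁) A‖ ^ 2 := by
  rw [norm_sq_Qstack, Finset.sum_eq_single (Fin.last (n + 1)), hB', WL2.norm_sq, Finset.mul_sum]
  · have key : ∀ i : ℕ, i = 0 →
        (∑ b : Bond d (towerP L m i), scaleLen (L : ℝ) η (n + 1) ^ ((d : ℤ) - 2) *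
          ‖φ.symm (Qlevels L m hL (UlevOf L m (n + 1) U) α hα1 hU1 hreg (n + 1) (fun b => φ (WL2.equiv ℂ _ W A b)) i b)‖ ^ 2) =
        ∑ b : Bond d m, c₁ * ‖WL2.equiv ℂ _ W (QkW L m n φ U hL α hα1 hU1 hreg (c₀ := c₀) (c₁ := c₁) A) b‖ ^ 2 := by
      rintro i rfl
      rw [hc₁]
      refine Finset.sum_congr rfl fun b _ => ?_
      rw [Qlevels_zero_eq_Qtower]
      rfl
    have hidx : n + 1 - ((Fin.last (n + 1) : Fin (n + 1 + 1)) : ℕ) = 0 := by simp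
    simpa only [Fin.val_last] using key _ hidx
  · intro j _ hj
    rw [hB j (fun h => hj (Fin.ext (by rw [h]; rfl))), Finset.sum_empty, mul_zero]
  · intro h; exact absurd (Finset.mem_univ _) h

/-- **`Q*(U)aQ(U)` in the small-field geometry IS the NE9 chain's `Q_k†(aQ_k)`** (weight `c₁ = (L^kη)^{d−2}` on the unit torus): two operators of the form
`T†(aT)` with equal quadratic forms coincide (complex polarization, `inner_map_self_eq_zero`). [cite: Balaban1985BackgroundPropagators, (3.16) p.393, (3.26) p.395] -/
theorem QaQ_smallField_eq (hB : ∀ j : Fin (n + 1 + 1), (j : ℕ) ≠ n + 1 → ΛB j = ∅) (hB' : ΛB (Fin.last (n + 1)) = Finset.univ)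
    (hc₁ : c₁ = scaleLen (L : ℝ) η (n + 1) ^ ((d : ℤ) - 2)) (a : ℝ) :
    QaQ L m (n + 1) φ η U ΛB hL α hα1 hU1 hreg (c₀ := c₀) a =
      LinearMap.adjoint (QkW L m n φ U hL α hα1 hU1 hreg (c₀ := c₀) (c₁ := c₁)) ∘ₗ ((a : ℂ) • QkW L m n φ U hL α hα1 hU1 hreg) := by
  rw [← sub_eq_zero, ← inner_map_self_eq_zero]
  intro A
  rw [LinearMap.sub_apply, inner_sub_left, QaQ, LinearMap.comp_apply, LinearMap.comp_apply, LinearMap.smul_apply, LinearMap.smul_apply,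
    LinearMap.adjoint_inner_left, LinearMap.adjoint_inner_left, inner_smul_left, inner_smul_left, inner_self_eq_norm_sq_to_K,
    inner_self_eq_norm_sq_to_K, RCLike.ofReal_eq_complex_ofReal, ← Complex.ofReal_pow, ← Complex.ofReal_pow,
    norm_sq_Qstack_smallField L m n φ η U ΛB hL α hα1 hU1 hreg hB hB' hc₁, sub_self]

variable [StarRing 𝔸] [StarModule ℂ 𝔸] (τ : 𝔸 →ₗ[ℂ] ℂ)

/-- **(3.26) IN THE SMALL-FIELD GEOMETRY IS THE NE9 `k`-TH-STEP OPERATOR**: with `Ω₀ = T_η`, `Λ_j = ∅` for `j < k`, `Λ_k = T^{(k)}` and the unit-torus weight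
`c₁ = (L^kη)^{d−2}`, `Δ_a(U)` of this file (multi-level `Q*aQ`, Dirichlet `R`) EQUALS `B9Eq326OperatorTower.laplaceAk` (top composite `Q_k(U)`, `R` onto
`Δ_U N(Q′_k(U))`, whole torus) — the NE9 chain's declared reading (M3) is print's (3.26) in the geometry without large-field holes.
[cite: Balaban1985BackgroundPropagators, (3.26) p.395] -/
theorem laplaceA_smallField_eq_laplaceAk (hS : ∀ j : Fin (n + 1 + 1), (j : ℕ) ≠ n + 1 → ΛS j = ∅) (hS' : ΛS (Fin.last (n + 1)) = Finset.univ)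
    (hB : ∀ j : Fin (n + 1 + 1), (j : ℕ) ≠ n + 1 → ΛB j = ∅) (hB' : ΛB (Fin.last (n + 1)) = Finset.univ)
    (hc₁ : c₁ = scaleLen (L : ℝ) η (n + 1) ^ ((d : ℤ) - 2)) (a : ℝ) :
    laplaceA L m (n + 1) φ η U Finset.univ ΛS ΛB τ hL α hα1 hU1 hreg (c₀ := c₀) a =
      laplaceAk L m n φ η U hL α hα1 hU1 hreg τ (c₀ := c₀) (c₁ := c₁) a := by
  rw [laplaceA_eq, Rtorus_univ_eq_RofUk L m n φ η U ΛS hS hS', QaQ_smallField_eq L m n φ η U ΛB hL α hα1 hU1 hreg hB hB' hc₁]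
  rfl

omit [NeZero L] [∀ i, NeZero (m i)] in
/-- With `Ω₀ = T_η` every bond is a bond of `Ω₀`. [cite: Balaban1985BackgroundPropagators, (3.27) p.395] -/
theorem bondsIn_univ {P : Fin d → ℕ} : bondsIn (Finset.univ : Finset (TSite d P)) = Finset.univ :=
  Finset.filter_true_of_mem fun _ _ => ⟨Finset.mem_univ _, Finset.mem_univ _⟩

/-- The positivity hypothesis of `G` for `Ω₀ = T_η` FOLLOWS from the NE9 chain's positivity of `laplaceAk` (same displayed Theorem 3.11 content).
[cite: Balaban1985BackgroundPropagators, Thm 3.11 p.416, (3.27) p.395] -/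
theorem hpos_dirichlet_univ (hS : ∀ j : Fin (n + 1 + 1), (j : ℕ) ≠ n + 1 → ΛS j = ∅) (hS' : ΛS (Fin.last (n + 1)) = Finset.univ)
    (hB : ∀ j : Fin (n + 1 + 1), (j : ℕ) ≠ n + 1 → ΛB j = ∅) (hB' : ΛB (Fin.last (n + 1)) = Finset.univ)
    (hc₁ : c₁ = scaleLen (L : ℝ) η (n + 1) ^ ((d : ℤ) - 2)) {a : ℝ}
    (hpos : ∀ x : BondL2K ℂ d (towerP L m (n + 1)) c₀ W, x ≠ 0 → 0 < RCLike.re ⟪x, laplaceAk L m n φ η U hL α hα1 hU1 hreg τ (c₀ := c₀) (c₁ := c₁) a x⟫_ℂ)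
    (x : L2On ℂ (bondsIn (Finset.univ : Finset (TSite d (towerP L m (n + 1))))) c₀ W) (hx : x ≠ 0) :
    0 < RCLike.re ⟪x, laplaceADir L m (n + 1) φ η U Finset.univ ΛS ΛB τ hL α hα1 hU1 hreg (c₀ := c₀) a x⟫_ℂ := by
  have hx' : extOn ℂ (bondsIn Finset.univ) x ≠ 0 := fun h => hx (by rw [← resOn_extOn ℂ (bondsIn Finset.univ) x, h, map_zero])
  have h := hpos _ hx'
  rw [← laplaceA_smallField_eq_laplaceAk L m n φ η U ΛS ΛB hL α hα1 hU1 hreg τ hS hS' hB hB' hc₁] at h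
  rwa [laplaceADir, LinearMap.comp_apply, LinearMap.comp_apply, ← inner_extOn_left]

/-- **(3.27) IN THE SMALL-FIELD GEOMETRY IS THE NE9 `G₁(U) = Δ_a(U)⁻¹`**: `Ω₀GΩ₀` (this file's `G` read on `L²(T_η, 𝔤)`, `Ω₀ = T_η`) equals
`B9Eq326OperatorTower.G1k` — both are the inverse of the same operator. [cite: Balaban1985BackgroundPropagators, (3.27) p.395; Balaban1985Variational, (110) p.294] -/
theorem Gtorus_smallField_eq_G1k (hS : ∀ j : Fin (n + 1 + 1), (j : ℕ) ≠ n + 1 → ΛS j = ∅) (hS' : ΛS (Fin.last (n + 1)) = Finset.univ)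
    (hB : ∀ j : Fin (n + 1 + 1), (j : ℕ) ≠ n + 1 → ΛB j = ∅) (hB' : ΛB (Fin.last (n + 1)) = Finset.univ)
    (hc₁ : c₁ = scaleLen (L : ℝ) η (n + 1) ^ ((d : ℤ) - 2)) {a : ℝ}
    (hpos : ∀ x : BondL2K ℂ d (towerP L m (n + 1)) c₀ W, x ≠ 0 → 0 < RCLike.re ⟪x, laplaceAk L m n φ η U hL α hα1 hU1 hreg τ (c₀ := c₀) (c₁ := c₁) a x⟫_ℂ) :
    Gtorus L m (n + 1) φ η U Finset.univ ΛS ΛB τ hL α hα1 hU1 hreg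
        (hpos_dirichlet_univ L m n φ η U ΛS ΛB hL α hα1 hU1 hreg τ hS hS' hB hB' hc₁ hpos) =
      G1k L m n φ η U hL α hα1 hU1 hreg τ (c₀ := c₀) (c₁ := c₁) (a := a) hpos := by
  have hchi : chiOn ℂ (bondsIn (Finset.univ : Finset (TSite d (towerP L m (n + 1))))) (c₀ := c₀) (W := W) = LinearMap.id := by
    apply LinearMap.ext; intro f; funext b
    exact (chiOn_apply ℂ _ f b).trans (if_pos (by rw [bondsIn_univ]; exact Finset.mem_univ b))
  -- Ω₀GΩ₀ is a left inverse of Δ_a = laplaceAk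
  have hleft := Gtorus_comp_dirichlet L m (n + 1) φ η U Finset.univ ΛS ΛB τ hL α hα1 hU1 hreg
    (hpos_dirichlet_univ L m n φ η U ΛS ΛB hL α hα1 hU1 hreg τ hS hS' hB hB' hc₁ hpos)
  rw [hchi, LinearMap.id_comp, LinearMap.comp_id, laplaceA_smallField_eq_laplaceAk L m n φ η U ΛS ΛB hL α hα1 hU1 hreg τ hS hS' hB hB' hc₁] at hleft
  apply LinearMap.ext
  intro x
  -- G1k is a right inverse: Δ_a (G1k x) = x
  have hright : laplaceAk L m n φ η U hL α hα1 hU1 hreg τ (c₀ := c₀) (c₁ := c₁) a (G1k L m n φ η U hL α hα1 hU1 hreg τ hpos x) = x :=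
    B11Eq103H1Complex.laplaceALatticeK_G1LatticeK hpos x
  have := LinearMap.congr_fun hleft (G1k L m n φ η U hL α hα1 hU1 hreg τ hpos x)
  rw [LinearMap.comp_apply, hright, LinearMap.id_apply] at this
  exact this

end SmallField

end Literature.MathematicalPhysics.QuantumFieldTheory.Balaban1983to89.B9Eq326MultiLevelSmallField

end
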